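import Literature.MathematicalPhysics.QuantumFieldTheory.Balaban1983to89.B14Eq356ExtensionFeed
import Literature.MathematicalPhysics.QuantumFieldTheory.Balaban1983to89.B14Eq357KernelDecay

/-!
# `Balaban1983to89.B14.Eq357ExtensionZd` — [Balaban1988Convergent] p. 281, the passage from (3.56) to (3.57) ON THE
# INFINITE LATTICE `L⁻ʲZ^d`: «we extend the sum on the right-hand side to all domains X ∈ 𝐃_j for the space L⁻ʲZ^d, X
# containing the point z. The difference between the two sums contributes to the irrelevant terms only, by the bounds
# (3.48)» — the two classes (I.3.5) above the cube of `z` on `L⁻ʲZ^d`, the FINITENESS of the first class «X ⊂ □̃^{∼2}», the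
# SUMMABILITY and the (3.48)-size `E₀K₀(4·2^d, 2d)e^{−κ(LʲL⁻ⁿ)⁻¹} ≤ E₀K₀(5/κ)⁵e⁻⁵(LʲL⁻ⁿ)⁵` of the second-class series (the
# extension difference) from (I.1.18) and [II] (1.26) on the infinite lattice, the EXTENSION IDENTITY «first-class sum =
# whole-lattice series − second-class series», and all of it AT CHART LEVEL for the main terms of (3.49)/(3.56)
# (`…B14.Eq356ExtensionFeed.mainTerm_le_of_chart`), in the `(L^{j−n})^{5−b}`-shape of `…Thm2Assembly.PointDataE`

HONEST FRAMING (cell `lit-balaban`, verbatim): statement-level skeleton of published theorems with citation tags;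
proofs where landed; nothing here is a claim about the Yang–Mills mass gap.

CITATION HEADER (lean-in-tree rule).  Source: T. Bałaban, *Convergent renormalization expansions for lattice gauge
theories*, Commun. Math. Phys. **119** (1988) 243–285, doi:10.1007/bf01217741 [Balaban1988Convergent] (cell paper
B14 = "[III]"; PDF held `paper:balaban1988-cmp119-convergent-renormalization`, journal page = PDF page + 242; text layer
p0038/p0039 re-read by the author of this file, 2026-08-22): (3.48) p. 280 [PDF 38] and the sentence before it p. 279,
(3.56)–(3.57) and the resummation paragraph p. 281 [PDF 39] tl.24–33, (2.27)(i)–(iv) p. 259 [PDF 17] («(iv) it satisfies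
the inequality (I.1.18)»); [I] = T. Bałaban, Commun. Math. Phys. **109** (1987) 249–301 [Balaban1987RG1], (1.18) p. 263
(«|𝐄^{(j)}(X, g_{j−1}, U, J)| ≤ E₀exp(−κd_j(X))»; v1 wrote `g_j` in this gloss), p. 257 (the localization domains 𝐃_j, d_j), (3.5) p. 271 (the two
classes), (4.3)–(4.5) pp. 281–282, (4.16)–(4.17) p. 285; [II] = T. Bałaban, Commun. Math. Phys. **116** (1988) 1–22
[Balaban1988RG2Cluster], (1.26) p. 8 (the tree-decay summability).  Mega-formalization `lit-balaban` (HOME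
`run/shared/lean/pub/lit-balaban/`), reader/typer unit `lit-balaban-r11` (generation 12, fold owner of B14), SKELETON
rows **B14.Eq3.55–3.57** (cell: the (3.56)→(3.57) extension), **B14.Eq3.48**, **B14.Thm2** (status cell, honest-frontier
item «the passage from the torus's domains to all domains X ∈ 𝐃_j for the space L⁻ʲZ^d»).  Imports the row's own
`…B14Eq356ExtensionFeed` (gen 11: the torus-side second-class part and `mainTerm_le_of_chart`) and `…B14Eq357KernelDecay`
(gen 6: the localization domains `LocDom d` of the infinite lattice and [II] (1.26) there, `sum_expAbove_le` /
`summable_expAbove` / `tsum_expAbove_le`), with `…B14.Eq348ClassGeometry` (gen 6: `InEnl`, `two_mul_le_treeLen_of_not_inEnl`)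
through the latter, and (v1.1, §6) `…TreeLengthCubeSystem` (`cubeSys`, `Cell`, `mem_cellsOf`) with `…Eq348ClassGeometry.SecondClass`/
`not_secondClass_iff`; uses them BY NAME; modifies nothing.  New vocabulary: two predicates (`SecondAbove`, `FirstAbove`)
and one finite set (`firstFinset`) with bodies; NO new `Prop`-valued named fact (D-0026).  v1.1 (same unit, gen 12) is
APPEND-ONLY: §6 + this header (one gloss corrected: [I] (1.18) carries `g_{j−1}`).

THE PRINTED TEXT (verbatim, p. 281 [PDF 39]).  *«Let us recall that (the irrelevant terms) above, and in (3.49),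
denotes the sum of terms which can be bounded by O((LʲL⁻ⁿ)^{5−β}) exp(−κd_j(X)), where β is a positive number. The
identities (3.56) hold for the localization domains X satisfying the condition X ⊂ □̃^{∼2}. We sum up the identities
over all such domains, and we extend the sum on the right-hand side to all domains X ∈ 𝐃_j for the space L⁻ʲZ^d, X
containing the point z. The difference between the two sums contributes to the irrelevant terms only, by the bounds
(3.48). Thus we obtain the identity (3.56) resummed over the domains X, but with the first expression on the right-hand
side replaced by ½ Σ Π^{(j)}_{μν,κλ} tr F_{κμ}(z)F_{λν}(z). (3.57) Here Π^{(j)}_{μν,κλ} = Σ_{x,y} Π^{(j)}_{μν}(x, y, z)(x_κ −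
z_κ)(y_λ − z_λ), and the function Π^{(j)}_{μν}(x, y, z) is given by the formula (3.50), but with 𝐄^{(j)}(X, U_j, z)
replaced by 𝐄^{(j)}(U_j, z) defined on the whole lattice L⁻ʲZ^d.»*; pp. 279–280 [PDF 37–38]: *«Consider the two cases
(I.3.5): X ⊂ □^{∼2}, X∩(□^{∼2})ᶜ ≠ ∅ (the ∼-operation is in the L⁻ⁿ-scale). In the second case the function 𝐄^{(j)}(X, z)
is already very small by the bound (I.1.18): |𝐄^{(j)}(X, z)| ≦ E₀ exp(−κ(LʲL⁻ⁿ)⁻¹) exp(−½κd_j(X)). (3.48) … the sum over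
X is bounded by O(1)exp(−κ(LʲL⁻ⁿ)⁻¹) ≦ O(1)(LʲL⁻ⁿ)⁵.»*

THE MODEL (that of `…B14.Eq357KernelDecay` / `…B14.Eq348ClassGeometry`, lattice units).  The cubes of π_j of the
infinite lattice `L⁻ʲZ^d` are indexed by `Pt d = ℤ^d`; the localization domains 𝐃_j of `L⁻ʲZ^d` are the non-empty
finite face-connected families of cube indices, `LocDom d`, with `d_j := TreeLength.treeLen`; the π_n-block of a cube
`y` is `coarse N y = ⌊y/N⌋`, `N = Lⁿ⁻ʲ`, and «`y ∈ □^{∼2}(x)`» is `InEnl N 2 x y` (block indices within 2 in every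
coordinate); «z ∈ X» is carried by the cube `x` of `z` being a cube of `X` (model notes (M1′)–(M2′) there).

WHAT THIS FILE PROVES (kernel-checked; no `sorry`).
* §1 `SecondAbove N x X` («X ∋ z, X∩(□^{∼2})ᶜ ≠ ∅») / `FirstAbove N x X` («X ∋ z, X ⊂ □^{∼2}») — the two classes (I.3.5)
  above the cube `x` on the infinite lattice; `mem_iff_firstAbove_or_secondAbove`, `not_firstAbove_and_secondAbove`
  (a partition of «X ∋ z»), `two_mul_le_treeLen_of_secondAbove` (d_j(X) ≥ 2N on the second class — `…Eq348ClassGeometry`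
  by name); **`finite_firstAbove`**: the first class above `x` is FINITE (its domains lie in the finite window
  `□^{∼2}(x)`, `finite_inEnl`), packaged as the finite set `firstFinset N x` (`mem_firstFinset`).
* §2 the second-class series — «the difference between the two sums … by the bounds (3.48)» — for reals `E(X)` obeying
  (I.1.18) on the second class above `x`, `κ/2 ≥ κ₀(4·2^d, 2d)` (the [II] (1.26) threshold of `B12TreeDecay`, constants
  depending on `d` only): every finite partial sum of `Σ_{X second class above x}|E(X)|` is `≤ E₀K₀(4·2^d, 2d)e^{−κN}`
  (`sum_abs_secondAbove_le`: (3.48) termwise by `B14Sect3.exp_split_348`, then (1.26) at `κ/2` on the infinite lattice,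
  `…Eq357KernelDecay.sum_expAbove_le`), hence **`summable_secondAbove`** and **`abs_tsum_secondAbove_le`** (the series
  converges absolutely, `|Σ'| ≤ E₀K₀e^{−κN}`), `…_le_pow_five` (`≤ E₀K₀(5/κ)⁵e⁻⁵(N⁻¹)⁵`, `B14Sect3.exp_neg_inv_le_pow_five`),
  `…_le_rpow` (`≤ E₀K₀(5/κ)⁵e⁻⁵(N⁻¹)^{5−b}`, every `b ≥ 0`).
* §3 THE EXTENSION IDENTITY: for any reals `m(X)` whose second-class series above `x` converges,
  **`tsum_above_eq_sum_first_add_tsum_second`** `Σ'_{X ∋ x} m(X) = Σ_{X ∈ firstFinset} m(X) + Σ'_{X second class} m(X)` (the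
  whole-lattice series over «X containing the point z» converges, `summable_above`), and `abs_sum_first_sub_tsum_le`:
  «the difference between the two sums» IS the second-class series, so any bound on it bounds
  `|Σ_{first class} m − Σ'_{X ∋ x} m|`.
* §4 AT CHART LEVEL (binders of `…Eq356ExtensionFeed.extensionDiff_secondClass_le`, torus cube system replaced by the
  infinite lattice): ONE cube `x` (of `z`, scale `n ≥ j`, `N = Lⁿ⁻ʲ`, `L ≥ 1` an integer), ONE functional `ℰ_X` per
  second-class domain of `L⁻ʲZ^d` above `x` whose chart `B ↦ ℰ_X(exp ρB)` is complex-analytic on `‖B‖ < α` and bounded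
  there by `E₀exp(−κd_j(X))` ((2.27)(ii) + (iv) = (I.1.18)), ONE set of field pieces `λ_z, c, ℓ` at `σ = LʲL⁻ⁿ`
  ((I.4.16)–(I.4.17)), real main terms `|m(X)| ≤ ‖½D²f_X(0)(w, w)‖`: **`extensionDiff_secondAbove_le`** — the second-class
  series of main terms converges and `|Σ'_{second} m| ≤ (C·E₀·K₀(4·2^d,2d)·(5/κ)⁵e⁻⁵)·(L^{j−n})^{5−β}` for every `β ≥ 0`,
  `C ≥ ½(4/α)²(a + ½ba²)²`; **`extension357_of_charts`** — the p. 281 sentence: the first-class sum of the main terms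
  (what summing (3.56) over «all such domains» gives) EQUALS the whole-lattice series over «X containing the point z»
  (the (3.57) coefficient before the `x, y`-bookkeeping) up to a term of the irrelevant size above.
* §5 torus ↔ `L⁻ʲZ^d` bookkeeping: `sum_torusFirst_eq_of_equiv` / **`abs_sum_torusFirst_sub_tsum_le`** — GIVEN an
  identification `e` of the first-class domains above `□_z` of a torus cube system (`B12TreeDecay.CubeSystem`, abstract
  class predicate as in `…Eq356ExtensionFeed`) with the first class above `x` on `L⁻ʲZ^d` carrying the same terms, the
  torus first-class sum equals the whole-lattice series minus the second-class series, and inherits the §3/§4 bound.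
* §6 (v1.1) THE IDENTIFICATION CONSTRUCTED for the cell's concrete carrier of (3.48), the window cube system
  `TreeLengthCubeSystem.cubeSys B` of `…Eq348ClassGeometry` §4 (class predicate `SecondClass B N c`): for every window
  `B ⊇ □^{∼2}(x)` the first-class domains above the cell `c = x` ARE the first-class domains of `L⁻ʲZ^d` above `x` — same
  cube sets (`exists_firstClassEquiv_window`, theorem-level: an `Equiv` preserving the family of cubes exists); hence
  `sum_windowFirst_eq` (the §5 identity with NO identification hypothesis, terms = one family `m` on `LocDom d` read on
  the window domains through their cube sets) and **`extension357_window_of_charts`** (the p. 281 sentence for the window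
  carrier under the §4 chart hypotheses alone).

HONEST SCOPE.  (1) The identification `e` of §5 — that for `X ⊂ □̃^{∼2}` the torus term 𝐄^{(j)}(X, U_k, z) IS the
corresponding term on `L⁻ʲZ^d` — is (2.27)(i) («it depends on U_k restricted to X») together with Bałaban's inductive
construction of the SAME local functionals on every lattice; in §5 it is a hypothesis (an `Equiv` with equal terms).
(v1.1) For the cell's WINDOW carrier `cubeSys B` (free boundary; the carrier on which `…Eq348ClassGeometry` discharges
`hclass`) the combinatorial half is CONSTRUCTED in §6 and the analytic half is definitional (one family `m` on `LocDom d`);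
for Bałaban's TORUS (`…TreeLengthTorus.tcubeSys`, wrap-around walls) it stays the reading: a torus wider than `5N` cubes
does not let `□̃^{∼2}` wrap, so its domains inside `□̃^{∼2}` lift uniquely — not formalised here (no `hclass` for
`torusTreeLen` in the tree either); row head policy G.5-45 unchanged.  (2) As in `…Eq356ExtensionFeed` the extension is
performed on the (3.49)-form `½⟨𝐄^{(2)}, w, w⟩` of the main term; print performs it at the (3.56) stage — same bilinear
power counting.  (3) Only the second class above `x` needs chart hypotheses; the first class is finite and enters
through its values `m(X)` alone.  (4) `E₀, κ` are the constants of (2.27)(iv) = (I.1.18) ([I] (1.18) p. 263); the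
(1.26) threshold and constant are `κ₀(4·2^d, 2d)`, `K₀(4·2^d, 2d)` of `B12TreeDecay` via the window theorem of
`TreeLengthCubeSystem` (free boundary, no wrap-around: the infinite lattice, as printed «for the space L⁻ʲZ^d»).
(5) Nothing about the torus's own second class (that is `…Eq356ExtensionFeed.extensionDiff_secondClass_le`), nothing
about (3.66)'s relocation estimates, nothing about the Yang–Mills mass gap.

## References
* [Balaban1988Convergent] T. Bałaban, Commun. Math. Phys. 119 (1988) 243–285: pp.279–280 (3.48), p.281 (3.56)–(3.57),
  (2.27) p.259.
* [Balaban1987RG1] T. Bałaban, Commun. Math. Phys. 109 (1987) 249–301 ([I]: p.257, (1.18) p.263, (3.5) p.271,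
  (4.3)–(4.5) pp.281–282, (4.16)–(4.17) p.285).
* [Balaban1988RG2Cluster] T. Bałaban, Commun. Math. Phys. 116 (1988) 1–22 ([II]: (1.26) p.8).
-/

open scoped Topology BigOperators

namespace Literature.MathematicalPhysics.QuantumFieldTheory.Balaban1983to89.B14.Eq357ExtensionZd

noncomputable section

open Literature.MathematicalPhysics.QuantumFieldTheory.Balaban1983to89
open Literature.MathematicalPhysics.QuantumFieldTheory.Balaban1983to89.B13ScaleTransfer
open Literature.MathematicalPhysics.QuantumFieldTheory.Balaban1983to89.TreeLength
open Literature.MathematicalPhysics.QuantumFieldTheory.Balaban1983to89.B12TreeDecay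
open Literature.MathematicalPhysics.QuantumFieldTheory.Balaban1983to89.B14.Eq348ClassGeometry
open Literature.MathematicalPhysics.QuantumFieldTheory.Balaban1983to89.B14.Eq357KernelDecay
open Finset

variable {d : ℕ}

/-! ## §1. The two classes (I.3.5) above the cube of `z` on the infinite lattice; the first class is finite -/

/-- **The second class above the cube `x`** on `L⁻ʲZ^d` (pp. 279–280): the localization domains `X ∈ 𝐃_j` of the
infinite lattice with `x` among their cubes («X containing the point z», `x` the cube of `z`) and some cube outside
`□^{∼2}(x)` («X∩(□^{∼2})ᶜ ≠ ∅ (the ∼-operation is in the L⁻ⁿ-scale)», `□` the π_n-block of `x`, blocks of `N = Lⁿ⁻ʲ`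
cubes). [cite: Balaban1988Convergent, p.279 (the two cases (I.3.5)), p.281] -/
def SecondAbove (N : ℕ) (x : Pt d) (X : LocDom d) : Prop := x ∈ X.1 ∧ ∃ y ∈ X.1, ¬ InEnl N 2 x y

/-- **The first class above the cube `x`** on `L⁻ʲZ^d` (p. 279 «X ⊂ □^{∼2}», p. 281 «the localization domains X
satisfying the condition X ⊂ □̃^{∼2}»): `x` is a cube of `X` and every cube of `X` lies in `□^{∼2}(x)`.
[cite: Balaban1988Convergent, p.279 (the two cases (I.3.5)), p.281] -/
def FirstAbove (N : ℕ) (x : Pt d) (X : LocDom d) : Prop := x ∈ X.1 ∧ ∀ y ∈ X.1, InEnl N 2 x y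

/-- Membership in the second class is decidable (a finite search over the cubes of `X`). [folklore] -/
instance instDecidableSecondAbove (N : ℕ) (x : Pt d) (X : LocDom d) : Decidable (SecondAbove N x X) := by
  unfold SecondAbove
  infer_instance

/-- Membership in the first class is decidable (a finite check over the cubes of `X`). [folklore] -/
instance instDecidableFirstAbove (N : ℕ) (x : Pt d) (X : LocDom d) : Decidable (FirstAbove N x X) := by
  unfold FirstAbove
  infer_instance

/-- Above `x`, the first class is the complement of the second («X ⊂ □^{∼2}» versus «X∩(□^{∼2})ᶜ ≠ ∅»).
[cite: Balaban1988Convergent, p.279 (the two cases (I.3.5))] -/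
theorem firstAbove_iff_not_secondAbove {N : ℕ} {x : Pt d} {X : LocDom d} (hx : x ∈ X.1) :
    FirstAbove N x X ↔ ¬ SecondAbove N x X := by
  simp only [FirstAbove, SecondAbove, hx, true_and, not_exists, not_and, not_not]

/-- «X containing the point z» splits into the two classes (I.3.5). [cite: Balaban1988Convergent, p.279 (the two cases (I.3.5))] -/
theorem mem_iff_firstAbove_or_secondAbove {N : ℕ} {x : Pt d} {X : LocDom d} :
    x ∈ X.1 ↔ FirstAbove N x X ∨ SecondAbove N x X := by
  constructor
  · intro hx
    by_cases h : SecondAbove N x X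
    · exact Or.inr h
    · exact Or.inl ((firstAbove_iff_not_secondAbove hx).2 h)
  · rintro (h | h)
    · exact h.1
    · exact h.1

/-- The two classes are disjoint. [cite: Balaban1988Convergent, p.279 (the two cases (I.3.5))] -/
theorem not_firstAbove_and_secondAbove {N : ℕ} {x : Pt d} {X : LocDom d} :
    ¬ (FirstAbove N x X ∧ SecondAbove N x X) := fun h =>
  (firstAbove_iff_not_secondAbove h.1.1).1 h.1 h.2

/-- **The geometry of the second class** (p. 280, the exponent of (3.48)): a second-class domain above `x` has
`d_j(X) ≥ 2N = 2(LʲL⁻ⁿ)⁻¹` — `…Eq348ClassGeometry.two_mul_le_treeLen_of_not_inEnl` by name.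
[cite: Balaban1988Convergent, (3.48) p.280] -/
theorem two_mul_le_treeLen_of_secondAbove {N : ℕ} (hN : 0 < N) {x : Pt d} {X : LocDom d}
    (h : SecondAbove N x X) : 2 * (N : ℝ) ≤ treeLen X.1 := by
  obtain ⟨y, hy, hny⟩ := h.2
  exact two_mul_le_treeLen_of_not_inEnl X.2.2 hN h.1 hy hny

/-- **The window `□^{∼r}(x)` is finite**: the cubes `y` of π_j whose π_n-block index is within `r` of that of `x` in
every coordinate lie in the integer box `N(⌊x/N⌋_i − r) ≤ y_i < N(⌊x/N⌋_i + r + 1)` (`coarse_eq_iff`; `N ≥ 1`).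
[cite: Balaban1987RG1, p.257 (the cubes □̃ⁿ of the size (1+2n)M)] -/
theorem finite_inEnl {N : ℕ} (hN : 0 < N) (r : ℕ) (x : Pt d) : {y : Pt d | InEnl N r x y}.Finite := by
  refine (Set.Finite.pi (t := fun i : Fin d =>
      Set.Icc ((N : ℤ) * (coarse N x i - r)) ((N : ℤ) * (coarse N x i + r + 1)))
    fun i => Set.finite_Icc _ _).subset ?_
  intro y hy
  rw [Set.mem_univ_pi]
  intro i
  have h := abs_le.1 (hy i)
  have hc := (coarse_eq_iff hN y (coarse N y)).1 rfl i
  have hN0 : (0 : ℤ) ≤ (N : ℤ) := by exact_mod_cast hN.le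
  have h1 : (N : ℤ) * (coarse N x i - r) ≤ (N : ℤ) * coarse N y i :=
    mul_le_mul_of_nonneg_left (by linarith [h.1]) hN0
  have h2 : (N : ℤ) * (coarse N y i + 1) ≤ (N : ℤ) * (coarse N x i + r + 1) :=
    mul_le_mul_of_nonneg_left (by linarith [h.2]) hN0
  exact ⟨by linarith [hc.1], by linarith [hc.2]⟩

/-- **The first class above `x` is FINITE** (its domains are families of cubes of the finite window `□^{∼2}(x)`): the
sum «over all such domains» of p. 281 is a finite sum. [cite: Balaban1988Convergent, p.281] -/
theorem finite_firstAbove {N : ℕ} (hN : 0 < N) (x : Pt d) : {X : LocDom d | FirstAbove N x X}.Finite := by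
  have hW := finite_inEnl hN 2 x
  have himg : ((fun X : LocDom d => X.1) '' {X : LocDom d | FirstAbove N x X}).Finite := by
    refine hW.toFinset.powerset.finite_toSet.subset ?_
    rintro _ ⟨X, hX, rfl⟩
    refine Finset.mem_coe.2 (Finset.mem_powerset.2 fun y hy => ?_)
    exact hW.mem_toFinset.2 (hX.2 y hy)
  exact Set.Finite.of_finite_image himg fun X _ Y _ h => Subtype.ext h

/-- **The first class above `x` as a finite set** of localization domains of `L⁻ʲZ^d` (`∅` in the degenerate case
`N = 0`, never used). [cite: Balaban1988Convergent, p.281] -/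
def firstFinset (N : ℕ) (x : Pt d) : Finset (LocDom d) :=
  if h : 0 < N then (finite_firstAbove h x).toFinset else ∅

/-- Membership in `firstFinset N x` is membership in the first class above `x` (`N ≥ 1`). [cite: Balaban1988Convergent, p.281] -/
@[simp] theorem mem_firstFinset {N : ℕ} (hN : 0 < N) {x : Pt d} {X : LocDom d} :
    X ∈ firstFinset N x ↔ FirstAbove N x X := by
  rw [firstFinset, dif_pos hN, Set.Finite.mem_toFinset]
  rfl

/-! ## §2. The second-class series above `x` from (I.1.18) and [II] (1.26) on the infinite lattice -/

/-- **(3.48) termwise, in (1.26)-form**: on the second class above `x`, `e^{−κd_j(X)} ≤ e^{−κN}·e^{−½κd_j(X)}` and the last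
factor is the general term `expAbove (κ/2) x X` of [II] (1.26) above `x` (`B14Sect3.exp_split_348`, `d_j(X) ≥ 2N`).
[cite: Balaban1988Convergent, (3.48) p.280] -/
theorem exp_le_expAbove_of_secondAbove {κ : ℝ} (hκ0 : 0 ≤ κ) {N : ℕ} (hN : 0 < N) {x : Pt d} {X : LocDom d}
    (h : SecondAbove N x X) : Real.exp (-κ * treeLen X.1) ≤ Real.exp (-(κ * N)) * expAbove (κ / 2) x X := by
  have hs := B14Sect3.exp_split_348 κ (treeLen X.1) N hκ0 (two_mul_le_treeLen_of_secondAbove hN h)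
  unfold expAbove
  rw [if_pos h.1]
  have e1 : -κ * treeLen X.1 = -(κ * treeLen X.1) := by ring
  have e2 : -(κ / 2) * treeLen X.1 = -(κ * treeLen X.1 / 2) := by ring
  rw [e1, e2]
  exact hs

/-- **«the sum over X is bounded by O(1)exp(−κ(LʲL⁻ⁿ)⁻¹)»** on the infinite lattice, decay factors: every finite partial
sum of `Σ_{X second class above x} e^{−κd_j(X)}` is `≤ e^{−κN}K₀(4·2^d, 2d)` for `κ/2 ≥ κ₀(4·2^d, 2d)` — (3.48) termwise and
[II] (1.26) at `κ/2` on `L⁻ʲZ^d` (`…Eq357KernelDecay.sum_expAbove_le`). [cite: Balaban1988Convergent, (3.48) p.280;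
Balaban1988RG2Cluster, (1.26) p.8] -/
theorem sum_exp_secondAbove_le {κ : ℝ} (hκ : kappa₀ (4 * 2 ^ d) (2 * d) ≤ κ / 2) (hκ0 : 0 ≤ κ) {N : ℕ} (hN : 0 < N)
    (x : Pt d) (F : Finset (LocDom d)) :
    ∑ X ∈ F.filter (SecondAbove N x), Real.exp (-κ * treeLen X.1) ≤ Real.exp (-(κ * N)) * K₀ (4 * 2 ^ d) (2 * d) := by
  calc ∑ X ∈ F.filter (SecondAbove N x), Real.exp (-κ * treeLen X.1)
      ≤ ∑ X ∈ F.filter (SecondAbove N x), Real.exp (-(κ * N)) * expAbove (κ / 2) x X :=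
        Finset.sum_le_sum fun X hX => exp_le_expAbove_of_secondAbove hκ0 hN (Finset.mem_filter.1 hX).2
    _ = Real.exp (-(κ * N)) * ∑ X ∈ F.filter (SecondAbove N x), expAbove (κ / 2) x X := (Finset.mul_sum _ _ _).symm
    _ ≤ Real.exp (-(κ * N)) * ∑ X ∈ F, expAbove (κ / 2) x X :=
        mul_le_mul_of_nonneg_left
          (Finset.sum_le_sum_of_subset_of_nonneg (Finset.filter_subset _ _) fun X _ _ => expAbove_nonneg _ _ _)
          (Real.exp_nonneg _)
    _ ≤ Real.exp (-(κ * N)) * K₀ (4 * 2 ^ d) (2 * d) :=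
        mul_le_mul_of_nonneg_left (sum_expAbove_le hκ x F) (Real.exp_nonneg _)

/-- **The termwise majorant of the second-class series**: for reals `E(X)` obeying (I.1.18) `|E(X)| ≤ E₀e^{−κd_j(X)}` on the
second class above `x`, the second-class term (extended by zero) is `≤ E₀e^{−κN}·expAbove (κ/2) x X` in norm.
[cite: Balaban1988Convergent, (3.48) p.280; Balaban1987RG1, (1.18) p.263] -/
theorem norm_secondAbove_term_le {E : LocDom d → ℝ} {E₀ κ : ℝ} (hE₀ : 0 ≤ E₀) (hκ0 : 0 ≤ κ) {N : ℕ} (hN : 0 < N)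
    (x : Pt d) (h118 : ∀ X, SecondAbove N x X → |E X| ≤ E₀ * Real.exp (-κ * treeLen X.1)) (X : LocDom d) :
    ‖(if SecondAbove N x X then E X else 0)‖ ≤ E₀ * Real.exp (-(κ * N)) * expAbove (κ / 2) x X := by
  rw [Real.norm_eq_abs]
  split_ifs with hX
  · calc |E X| ≤ E₀ * Real.exp (-κ * treeLen X.1) := h118 X hX
      _ ≤ E₀ * (Real.exp (-(κ * N)) * expAbove (κ / 2) x X) :=
          mul_le_mul_of_nonneg_left (exp_le_expAbove_of_secondAbove hκ0 hN hX) hE₀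
      _ = E₀ * Real.exp (-(κ * N)) * expAbove (κ / 2) x X := by ring
  · rw [abs_zero]
    exact mul_nonneg (mul_nonneg hE₀ (Real.exp_nonneg _)) (expAbove_nonneg _ _ _)

/-- **Finite partial sums of the second-class series** (p. 280 «the sum over X is bounded by O(1)exp(−κ(LʲL⁻ⁿ)⁻¹)» on
`L⁻ʲZ^d`): `Σ_{X ∈ F, second class above x}|E(X)| ≤ E₀K₀(4·2^d, 2d)e^{−κN}` for every finite family `F`, from (I.1.18) on
the second class and `κ/2 ≥ κ₀(4·2^d, 2d)`. [cite: Balaban1988Convergent, (3.48) p.280; Balaban1988RG2Cluster, (1.26) p.8] -/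
theorem sum_abs_secondAbove_le {E : LocDom d → ℝ} {E₀ κ : ℝ} (hE₀ : 0 ≤ E₀)
    (hκ : kappa₀ (4 * 2 ^ d) (2 * d) ≤ κ / 2) (hκ0 : 0 ≤ κ) {N : ℕ} (hN : 0 < N) (x : Pt d)
    (h118 : ∀ X, SecondAbove N x X → |E X| ≤ E₀ * Real.exp (-κ * treeLen X.1)) (F : Finset (LocDom d)) :
    ∑ X ∈ F.filter (SecondAbove N x), |E X| ≤ E₀ * K₀ (4 * 2 ^ d) (2 * d) * Real.exp (-(κ * N)) := by
  have hK : 0 ≤ E₀ := hE₀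
  calc ∑ X ∈ F.filter (SecondAbove N x), |E X|
      ≤ ∑ X ∈ F.filter (SecondAbove N x), E₀ * Real.exp (-κ * treeLen X.1) :=
        Finset.sum_le_sum fun X hX => h118 X (Finset.mem_filter.1 hX).2
    _ = E₀ * ∑ X ∈ F.filter (SecondAbove N x), Real.exp (-κ * treeLen X.1) := (Finset.mul_sum _ _ _).symm
    _ ≤ E₀ * (Real.exp (-(κ * N)) * K₀ (4 * 2 ^ d) (2 * d)) :=
        mul_le_mul_of_nonneg_left (sum_exp_secondAbove_le hκ hκ0 hN x F) hK
    _ = E₀ * K₀ (4 * 2 ^ d) (2 * d) * Real.exp (-(κ * N)) := by ring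

/-- **The second-class series above `x` CONVERGES** (absolutely; comparison with the (1.26)-series at `κ/2`,
`…Eq357KernelDecay.summable_expAbove`) — the extension to «all domains X ∈ 𝐃_j for the space L⁻ʲZ^d, X containing the
point z» is a convergent series. [cite: Balaban1988Convergent, p.281; Balaban1988RG2Cluster, (1.26) p.8] -/
theorem summable_secondAbove {E : LocDom d → ℝ} {E₀ κ : ℝ} (hE₀ : 0 ≤ E₀)
    (hκ : kappa₀ (4 * 2 ^ d) (2 * d) ≤ κ / 2) (hκ0 : 0 ≤ κ) {N : ℕ} (hN : 0 < N) (x : Pt d)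
    (h118 : ∀ X, SecondAbove N x X → |E X| ≤ E₀ * Real.exp (-κ * treeLen X.1)) :
    Summable fun X : LocDom d => if SecondAbove N x X then E X else 0 := by
  have hκ' : kappa₀ (4 * 2 ^ d) (2 * d) ≤ κ / 2 := hκ
  refine Summable.of_norm_bounded (g := fun X => E₀ * Real.exp (-(κ * N)) * expAbove (κ / 2) x X) ?_ fun X => ?_
  · exact (summable_expAbove hκ' x).mul_left _
  · exact norm_secondAbove_term_le hE₀ hκ0 hN x h118 X

/-- **«The difference between the two sums contributes to the irrelevant terms only, by the bounds (3.48)»**, the size on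
`L⁻ʲZ^d`: `|Σ'_{X second class above x} E(X)| ≤ E₀K₀(4·2^d, 2d)e^{−κN}` (the series majorised termwise by the (1.26)-series at
`κ/2`, `…Eq357KernelDecay.tsum_expAbove_le`). [cite: Balaban1988Convergent, p.281, (3.48) p.280; Balaban1988RG2Cluster, (1.26) p.8] -/
theorem abs_tsum_secondAbove_le {E : LocDom d → ℝ} {E₀ κ : ℝ} (hE₀ : 0 ≤ E₀)
    (hκ : kappa₀ (4 * 2 ^ d) (2 * d) ≤ κ / 2) (hκ0 : 0 ≤ κ) {N : ℕ} (hN : 0 < N) (x : Pt d)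
    (h118 : ∀ X, SecondAbove N x X → |E X| ≤ E₀ * Real.exp (-κ * treeLen X.1)) :
    |∑' X : LocDom d, (if SecondAbove N x X then E X else 0)| ≤ E₀ * K₀ (4 * 2 ^ d) (2 * d) * Real.exp (-(κ * N)) := by
  set W : ℝ := E₀ * Real.exp (-(κ * N)) with hW_def
  have hW : 0 ≤ W := mul_nonneg hE₀ (Real.exp_nonneg _)
  have hg : Summable fun X : LocDom d => W * expAbove (κ / 2) x X := (summable_expAbove hκ x).mul_left W
  calc |∑' X : LocDom d, (if SecondAbove N x X then E X else 0)|
      = ‖∑' X : LocDom d, (if SecondAbove N x X then E X else 0)‖ := (Real.norm_eq_abs _).symm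
    _ ≤ ∑' X : LocDom d, W * expAbove (κ / 2) x X :=
        tsum_of_norm_bounded hg.hasSum (norm_secondAbove_term_le hE₀ hκ0 hN x h118)
    _ = W * ∑' X : LocDom d, expAbove (κ / 2) x X := tsum_mul_left
    _ ≤ W * K₀ (4 * 2 ^ d) (2 * d) := mul_le_mul_of_nonneg_left (tsum_expAbove_le hκ x) hW
    _ = E₀ * K₀ (4 * 2 ^ d) (2 * d) * Real.exp (-(κ * N)) := by rw [hW_def]; ring

/-- **«≦ O(1)(LʲL⁻ⁿ)⁵»** on `L⁻ʲZ^d`: `|Σ'_{second class} E(X)| ≤ E₀K₀(4·2^d, 2d)(5/κ)⁵e⁻⁵·(N⁻¹)⁵` (`κ > 0`, `N⁻¹ = LʲL⁻ⁿ`;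
`B14Sect3.exp_neg_inv_le_pow_five`). [cite: Balaban1988Convergent, (3.48) p.280] -/
theorem abs_tsum_secondAbove_le_pow_five {E : LocDom d → ℝ} {E₀ κ : ℝ} (hE₀ : 0 ≤ E₀)
    (hκ : kappa₀ (4 * 2 ^ d) (2 * d) ≤ κ / 2) (hκ0 : 0 < κ) {N : ℕ} (hN : 0 < N) (x : Pt d)
    (h118 : ∀ X, SecondAbove N x X → |E X| ≤ E₀ * Real.exp (-κ * treeLen X.1)) :
    |∑' X : LocDom d, (if SecondAbove N x X then E X else 0)|
      ≤ E₀ * K₀ (4 * 2 ^ d) (2 * d) * (((5 : ℝ) / κ) ^ 5 * Real.exp (-(5 : ℝ))) * ((N : ℝ)⁻¹) ^ 5 := by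
  have hN' : (0 : ℝ) < (N : ℝ)⁻¹ := inv_pos.2 (by exact_mod_cast hN)
  have h1 := abs_tsum_secondAbove_le hE₀ hκ hκ0.le hN x h118
  have h2 := B14Sect3.exp_neg_inv_le_pow_five κ ((N : ℝ)⁻¹) hκ0 hN'
  rw [inv_inv] at h2
  have hK : 0 ≤ E₀ * K₀ (4 * 2 ^ d) (2 * d) := mul_nonneg hE₀ (K₀_pos _ _).le
  calc |∑' X : LocDom d, (if SecondAbove N x X then E X else 0)|
      ≤ E₀ * K₀ (4 * 2 ^ d) (2 * d) * Real.exp (-(κ * N)) := h1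
    _ ≤ E₀ * K₀ (4 * 2 ^ d) (2 * d) * (((5 : ℝ) / κ) ^ 5 * Real.exp (-(5 : ℝ)) * ((N : ℝ)⁻¹) ^ 5) :=
        mul_le_mul_of_nonneg_left h2 hK
    _ = E₀ * K₀ (4 * 2 ^ d) (2 * d) * (((5 : ℝ) / κ) ^ 5 * Real.exp (-(5 : ℝ))) * ((N : ℝ)⁻¹) ^ 5 := by ring

/-- For `0 < s ≤ 1` and `0 ≤ b`, `s⁵ ≤ s^{5−b}` (an `O(s⁵)` error is an `O(s^{5−β})` one). [folklore] -/
private theorem pow_five_le_rpow {s b : ℝ} (hs : 0 < s) (hs1 : s ≤ 1) (hb : 0 ≤ b) : s ^ 5 ≤ s ^ ((5 : ℝ) - b) := by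
  have h : s ^ ((5 : ℝ)) ≤ s ^ ((5 : ℝ) - b) := Real.rpow_le_rpow_of_exponent_ge hs hs1 (by linarith)
  have e : s ^ ((5 : ℝ)) = s ^ 5 := by exact_mod_cast Real.rpow_natCast s 5
  rw [e] at h
  exact h

/-- **The second-class series in the `(N⁻¹)^{5−b}`-shape** of the per-point irrelevant inputs (`…Thm2Assembly.PointDataE`):
`|Σ'_{second class} E(X)| ≤ E₀K₀(4·2^d, 2d)(5/κ)⁵e⁻⁵·(N⁻¹)^{5−b}` for every `b ≥ 0`. [cite: Balaban1988Convergent, (3.48) p.280, p.281] -/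
theorem abs_tsum_secondAbove_le_rpow {E : LocDom d → ℝ} {E₀ κ b : ℝ} (hE₀ : 0 ≤ E₀)
    (hκ : kappa₀ (4 * 2 ^ d) (2 * d) ≤ κ / 2) (hκ0 : 0 < κ) (hb : 0 ≤ b) {N : ℕ} (hN : 0 < N) (x : Pt d)
    (h118 : ∀ X, SecondAbove N x X → |E X| ≤ E₀ * Real.exp (-κ * treeLen X.1)) :
    |∑' X : LocDom d, (if SecondAbove N x X then E X else 0)|
      ≤ E₀ * K₀ (4 * 2 ^ d) (2 * d) * (((5 : ℝ) / κ) ^ 5 * Real.exp (-(5 : ℝ))) * ((N : ℝ)⁻¹) ^ ((5 : ℝ) - b) := by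
  have hN1 : (1 : ℝ) ≤ N := by exact_mod_cast hN
  have hs : (0 : ℝ) < (N : ℝ)⁻¹ := inv_pos.2 (by linarith)
  have hs1 : (N : ℝ)⁻¹ ≤ 1 := inv_le_one_of_one_le₀ hN1
  have hK : 0 ≤ E₀ * K₀ (4 * 2 ^ d) (2 * d) * (((5 : ℝ) / κ) ^ 5 * Real.exp (-(5 : ℝ))) :=
    mul_nonneg (mul_nonneg hE₀ (K₀_pos _ _).le)
      (mul_nonneg (pow_nonneg (div_nonneg (by norm_num) hκ0.le) 5) (Real.exp_nonneg _))
  exact (abs_tsum_secondAbove_le_pow_five hE₀ hκ hκ0 hN x h118).trans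
    (mul_le_mul_of_nonneg_left (pow_five_le_rpow hs hs1 hb) hK)

/-! ## §3. The extension identity: first-class sum = whole-lattice series − second-class series -/

/-- Pointwise, «X ∋ z» = first class + second class (terms extended by zero). [cite: Balaban1988Convergent, p.279 (the two cases (I.3.5))] -/
theorem above_term_eq_add (N : ℕ) (x : Pt d) (m : LocDom d → ℝ) (X : LocDom d) :
    (if x ∈ X.1 then m X else 0)
      = (if FirstAbove N x X then m X else 0) + (if SecondAbove N x X then m X else 0) := by
  by_cases hx : x ∈ X.1
  · rw [if_pos hx]
    by_cases h2 : SecondAbove N x X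
    · have h1 : ¬ FirstAbove N x X := fun h1 => not_firstAbove_and_secondAbove ⟨h1, h2⟩
      rw [if_neg h1, if_pos h2, zero_add]
    · rw [if_pos ((firstAbove_iff_not_secondAbove hx).2 h2), if_neg h2, add_zero]
  · have h1 : ¬ FirstAbove N x X := fun h => hx h.1
    have h2 : ¬ SecondAbove N x X := fun h => hx h.1
    rw [if_neg hx, if_neg h1, if_neg h2, add_zero]

/-- The first-class terms (extended by zero) vanish off the finite set `firstFinset N x`. [cite: Balaban1988Convergent, p.281] -/
theorem first_term_eq_zero_of_not_mem {N : ℕ} (hN : 0 < N) (x : Pt d) (m : LocDom d → ℝ) :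
    ∀ X ∉ firstFinset N x, (if FirstAbove N x X then m X else 0) = 0 := by
  intro X hX
  rw [if_neg]
  exact fun h => hX ((mem_firstFinset hN).2 h)

/-- **The sum «over all such domains» is finite**: the series of the first-class terms IS the finite sum over
`firstFinset N x`. [cite: Balaban1988Convergent, p.281] -/
theorem tsum_first_eq_sum {N : ℕ} (hN : 0 < N) (x : Pt d) (m : LocDom d → ℝ) :
    ∑' X : LocDom d, (if FirstAbove N x X then m X else 0) = ∑ X ∈ firstFinset N x, m X := by
  rw [tsum_eq_sum (first_term_eq_zero_of_not_mem hN x m)]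
  exact Finset.sum_congr rfl fun X hX => if_pos ((mem_firstFinset hN).1 hX)

/-- **The whole-lattice series over «X containing the point z» CONVERGES** as soon as its second-class part does (the
first class being finite). [cite: Balaban1988Convergent, p.281] -/
theorem summable_above {N : ℕ} (hN : 0 < N) (x : Pt d) {m : LocDom d → ℝ}
    (hs : Summable fun X : LocDom d => if SecondAbove N x X then m X else 0) :
    Summable fun X : LocDom d => if x ∈ X.1 then m X else 0 := by
  have hf : Summable fun X : LocDom d => if FirstAbove N x X then m X else 0 :=
    summable_of_ne_finset_zero (first_term_eq_zero_of_not_mem hN x m)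
  have e : (fun X : LocDom d => if x ∈ X.1 then m X else 0)
      = fun X => (if FirstAbove N x X then m X else 0) + (if SecondAbove N x X then m X else 0) :=
    funext (above_term_eq_add N x m)
  rw [e]
  exact hf.add hs

/-- **THE EXTENSION IDENTITY** (p. 281 «we extend the sum on the right-hand side to all domains X ∈ 𝐃_j for the space
L⁻ʲZ^d, X containing the point z. The difference between the two sums …»): `Σ'_{X ∋ x} m(X) = Σ_{X first class} m(X) +
Σ'_{X second class} m(X)` whenever the second-class series converges. [cite: Balaban1988Convergent, p.281, (3.56)–(3.57) p.281] -/
theorem tsum_above_eq_sum_first_add_tsum_second {N : ℕ} (hN : 0 < N) (x : Pt d) {m : LocDom d → ℝ}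
    (hs : Summable fun X : LocDom d => if SecondAbove N x X then m X else 0) :
    ∑' X : LocDom d, (if x ∈ X.1 then m X else 0)
      = ∑ X ∈ firstFinset N x, m X + ∑' X : LocDom d, (if SecondAbove N x X then m X else 0) := by
  have hf : Summable fun X : LocDom d => if FirstAbove N x X then m X else 0 :=
    summable_of_ne_finset_zero (first_term_eq_zero_of_not_mem hN x m)
  have e : (fun X : LocDom d => if x ∈ X.1 then m X else 0)
      = fun X => (if FirstAbove N x X then m X else 0) + (if SecondAbove N x X then m X else 0) :=
    funext (above_term_eq_add N x m)
  rw [e, hf.tsum_add hs, tsum_first_eq_sum hN x m]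

/-- **«The difference between the two sums contributes to the irrelevant terms only»** — abstract form: any bound `R` on
the second-class series bounds `|Σ_{first class} m − Σ'_{X ∋ x} m|`. [cite: Balaban1988Convergent, p.281] -/
theorem abs_sum_first_sub_tsum_le {N : ℕ} (hN : 0 < N) (x : Pt d) {m : LocDom d → ℝ} {R : ℝ}
    (hs : Summable fun X : LocDom d => if SecondAbove N x X then m X else 0)
    (hR : |∑' X : LocDom d, (if SecondAbove N x X then m X else 0)| ≤ R) :
    |∑ X ∈ firstFinset N x, m X - ∑' X : LocDom d, (if x ∈ X.1 then m X else 0)| ≤ R := by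
  rw [tsum_above_eq_sum_first_add_tsum_second hN x hs]
  have e : ∑ X ∈ firstFinset N x, m X
      - (∑ X ∈ firstFinset N x, m X + ∑' X : LocDom d, (if SecondAbove N x X then m X else 0))
      = -∑' X : LocDom d, (if SecondAbove N x X then m X else 0) := by ring
  rw [e, abs_neg]
  exact hR

/-! ## §4. At chart level: the main terms of (3.49)/(3.56) on the second class of `L⁻ʲZ^d`, and the p. 281 sentence -/

section Chart

open NormedSpace (exp)

variable {𝔄 : Type*} [NormedRing 𝔄] [NormedAlgebra ℝ 𝔄] {Λ T : Type*} [Fintype Λ] [Fintype T]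
  {V : Type*} [NormedAddCommGroup V] [NormedSpace ℂ V] {F : Type*} [NormedAddCommGroup F]
  [NormedSpace ℂ F] [CompleteSpace F]

/-- `LʲL⁻ⁿ` as printed: for `j ≤ n` and `L > 0`, the real power `L^{(j−n)}` of `B14Sect3.Rep367`/`PointDataE` is
`(Lⁿ⁻ʲ)⁻¹ = N⁻¹`. [folklore] -/
private theorem rpow_sub_eq_inv_pow {L : ℝ} (hL : 0 < L) {j n : ℕ} (hjn : j ≤ n) :
    L ^ ((j : ℝ) - n) = ((L ^ (n - j) : ℝ))⁻¹ := by
  rw [Real.rpow_sub hL, Real.rpow_natCast, Real.rpow_natCast]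
  rw [← pow_sub_mul_pow L hjn]
  field_simp

/-- `(4:ℕ)`-th power of a number in `[0, 1]` is at most `1`. [folklore] -/
private theorem pow_four_le_one {σ : ℝ} (hσ0 : 0 ≤ σ) (hσ1 : σ ≤ 1) : σ ^ 4 ≤ 1 := pow_le_one₀ hσ0 hσ1

-- (the nested operator space over the iterated `Pi` type: one more level of pending instance synthesis)
set_option maxSynthPendingDepth 3 in
/-- **p. 281, the extension difference AT CHART LEVEL on `L⁻ʲZ^d`**: ONE cube `x` (of `z`, scale `n ≥ j`, `N = Lⁿ⁻ʲ`,
`L ≥ 1` an integer, `κ/2 ≥ κ₀(4·2^d, 2d)`, `κ > 0`); ONE functional `ℰ_X` per second-class domain of the infinite lattice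
above `x` whose chart is complex-analytic on `‖B‖ < α` and bounded there by `E₀exp(−κd_j(X))` ((2.27)(ii) + (iv) =
(I.1.18)); ONE set of field pieces `λ_z, c, ℓ` at `σ = LʲL⁻ⁿ` ((I.4.16)–(I.4.17)); real main terms `|m(X)| ≤ ‖½D²f_X(0)(w,
w)‖`, `w = ℓ + ½ i[λ_z, c]`.  Then the second-class series of main terms — «the difference between the two sums» —
CONVERGES and `|Σ'_{X second class above x} m(X)| ≤ (C·E₀·K₀(4·2^d, 2d)·(5/κ)⁵e⁻⁵)·(L^{j−n})^{5−β}` for every `β ≥ 0` and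
every `C ≥ ½(4/α)²(a + ½ba²)²` (`…Eq356ExtensionFeed.mainTerm_le_of_chart` termwise, the surplus `σ⁴ ≤ 1` dropped, then
§2). [cite: Balaban1988Convergent, p.281, (3.48) p.280, (3.56)–(3.57) p.281, (2.27) p.259; Balaban1987RG1, (1.18) p.263,
(4.3)–(4.5) pp.281–282, (4.16)–(4.17) p.285; Balaban1988RG2Cluster, (1.26) p.8] -/
theorem extensionDiff_secondAbove_le
    {𝔤 : Type*} [LieRing 𝔤] [LieAlgebra ℝ 𝔤] (eV : V ≃ₗ[ℝ] 𝔤) (ρ : V →L[ℝ] 𝔄) {α : ℝ} (hα : 0 < α) {E₀ : ℝ}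
    (hE₀ : 0 ≤ E₀) {b : ℝ} (hb0 : 0 ≤ b) (hb : ∀ x y : V, ‖eV.symm ⁅eV x, eV y⁆‖ ≤ b * ‖x‖ * ‖y‖)
    {a : ℝ} (ha : 0 ≤ a) {C : ℝ} (hC : (2 : ℝ)⁻¹ * (4 / α) ^ 2 * (a + (2 : ℝ)⁻¹ * b * a ^ 2) ^ 2 ≤ C)
    {κ : ℝ} (hκ : kappa₀ (4 * 2 ^ d) (2 * d) ≤ κ / 2) (hκ0 : 0 < κ)
    {L : ℕ} (hL : 0 < L) {j n : ℕ} (hjn : j ≤ n) {β : ℝ} (hβ0 : 0 ≤ β)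
    (x : Pt d) (ℰ : LocDom d → (Λ → T → 𝔄) → F)
    (hf : ∀ X, SecondAbove (L ^ (n - j)) x X →
      AnalyticOnNhd ℂ (fun A' : Λ → T → V => ℰ X (fun ν y => exp (ρ (A' ν y)))) (Metric.ball 0 α))
    (hS : ∀ X, SecondAbove (L ^ (n - j)) x X → ∀ A' ∈ Metric.ball (0 : Λ → T → V) α,
      ‖ℰ X (fun ν y => exp (ρ (A' ν y)))‖ ≤ E₀ * Real.exp (-κ * treeLen X.1))
    (lam : T → V) (c ℓ : Λ → T → V) (hcn : ‖c‖ ≤ a * (L : ℝ) ^ ((j : ℝ) - n))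
    (hlam : ‖lam‖ ≤ a * (L : ℝ) ^ ((j : ℝ) - n)) (hℓ : ‖ℓ‖ ≤ a * ((L : ℝ) ^ ((j : ℝ) - n)) ^ 2)
    (m : LocDom d → ℝ)
    (hm : ∀ X, SecondAbove (L ^ (n - j)) x X → |m X| ≤
      ‖(2 : ℝ)⁻¹ • fderiv ℝ (fderiv ℝ (fun A' : Λ → T → V => ℰ X (fun ν y => exp (ρ (A' ν y))))) 0
        (ℓ + (2 : ℝ)⁻¹ • fun ν y => eV.symm ⁅eV (lam y), eV (c ν y)⁆)
        (ℓ + (2 : ℝ)⁻¹ • fun ν y => eV.symm ⁅eV (lam y), eV (c ν y)⁆)‖) :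
    (Summable fun X : LocDom d => if SecondAbove (L ^ (n - j)) x X then m X else 0) ∧
    |∑' X : LocDom d, (if SecondAbove (L ^ (n - j)) x X then m X else 0)|
      ≤ (C * E₀ * K₀ (4 * 2 ^ d) (2 * d) * (((5 : ℝ) / κ) ^ 5 * Real.exp (-(5 : ℝ))))
        * ((L : ℝ) ^ ((j : ℝ) - n)) ^ ((5 : ℝ) - β) := by
  set s : ℝ := (L : ℝ) ^ ((j : ℝ) - n) with hs_def
  have hL0 : (0 : ℝ) < L := by exact_mod_cast hL
  have hL1 : (1 : ℝ) ≤ L := by exact_mod_cast hL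
  have hs0 : 0 < s := Real.rpow_pos_of_pos hL0 _
  have hs1 : s ≤ 1 := by
    apply Real.rpow_le_one_of_one_le_of_nonpos hL1
    have : (j : ℝ) ≤ n := by exact_mod_cast hjn
    linarith
  have hN : 0 < L ^ (n - j) := pow_pos hL _
  have hsN : s = (((L ^ (n - j) : ℕ) : ℝ))⁻¹ := by
    rw [hs_def, rpow_sub_eq_inv_pow hL0 hjn]
    push_cast
    rfl
  have hC0 : 0 ≤ C := le_trans (by positivity) hC
  have hCE : 0 ≤ C * E₀ := mul_nonneg hC0 hE₀
  -- (I.1.18) for the main terms on the second class, constant `C·E₀` (surplus `σ⁴ ≤ 1` dropped)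
  have h118 : ∀ X, SecondAbove (L ^ (n - j)) x X → |m X| ≤ C * E₀ * Real.exp (-κ * treeLen X.1) := by
    intro X hX
    have h := Eq356ExtensionFeed.mainTerm_le_of_chart eV ρ hα hE₀ (hf X hX) (hS X hX) hb0 hb lam c ℓ ha hs0.le hcn
      hlam hℓ hC (hm X hX)
    have hw : C * s ^ 4 * E₀ * Real.exp (-κ * treeLen X.1) ≤ C * 1 * E₀ * Real.exp (-κ * treeLen X.1) := by
      have : 0 ≤ C * E₀ * Real.exp (-κ * treeLen X.1) := mul_nonneg hCE (Real.exp_nonneg _)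
      nlinarith [pow_four_le_one hs0.le hs1, this]
    calc |m X| ≤ C * s ^ 4 * E₀ * Real.exp (-κ * treeLen X.1) := h
      _ ≤ C * 1 * E₀ * Real.exp (-κ * treeLen X.1) := hw
      _ = C * E₀ * Real.exp (-κ * treeLen X.1) := by ring
  refine ⟨summable_secondAbove hCE hκ hκ0.le hN x h118, ?_⟩
  have key := abs_tsum_secondAbove_le_rpow hCE hκ hκ0 hβ0 hN x h118
  rw [← hsN] at key
  calc |∑' X : LocDom d, (if SecondAbove (L ^ (n - j)) x X then m X else 0)|
      ≤ C * E₀ * K₀ (4 * 2 ^ d) (2 * d) * (((5 : ℝ) / κ) ^ 5 * Real.exp (-(5 : ℝ))) * s ^ ((5 : ℝ) - β) := key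
    _ = (C * E₀ * K₀ (4 * 2 ^ d) (2 * d) * (((5 : ℝ) / κ) ^ 5 * Real.exp (-(5 : ℝ)))) * s ^ ((5 : ℝ) - β) := by
        ring

-- (the nested operator space over the iterated `Pi` type: one more level of pending instance synthesis)
set_option maxSynthPendingDepth 3 in
/-- **p. 281, the sentence itself, AT CHART LEVEL on `L⁻ʲZ^d`**: «We sum up the identities over all such domains [X ∋ z,
X ⊂ □̃^{∼2}], and we extend the sum on the right-hand side to all domains X ∈ 𝐃_j for the space L⁻ʲZ^d, X containing the
point z. The difference between the two sums contributes to the irrelevant terms only, by the bounds (3.48).» — under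
the hypotheses of `extensionDiff_secondAbove_le` (chart data on the second class above the cube `x` of `z` only), for
ANY real main terms `m(X)` of the first class: the whole-lattice series `Σ'_{X ∋ x} m(X)` (the coefficient entering
(3.57)) CONVERGES and `|Σ_{X ∈ firstFinset} m(X) − Σ'_{X ∋ x} m(X)| ≤ (C·E₀·K₀(4·2^d, 2d)·(5/κ)⁵e⁻⁵)·(L^{j−n})^{5−β}` — a
per-point irrelevant term of the shape `c·(L^{j−n})^{5−b}` of `…Thm2Assembly.PointDataE`. [cite: Balaban1988Convergent,
(3.56)–(3.57) p.281, (3.48) p.280, (2.27) p.259; Balaban1987RG1, (1.18) p.263, (4.16)–(4.17) p.285; Balaban1988RG2Cluster,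
(1.26) p.8] -/
theorem extension357_of_charts
    {𝔤 : Type*} [LieRing 𝔤] [LieAlgebra ℝ 𝔤] (eV : V ≃ₗ[ℝ] 𝔤) (ρ : V →L[ℝ] 𝔄) {α : ℝ} (hα : 0 < α) {E₀ : ℝ}
    (hE₀ : 0 ≤ E₀) {b : ℝ} (hb0 : 0 ≤ b) (hb : ∀ x y : V, ‖eV.symm ⁅eV x, eV y⁆‖ ≤ b * ‖x‖ * ‖y‖)
    {a : ℝ} (ha : 0 ≤ a) {C : ℝ} (hC : (2 : ℝ)⁻¹ * (4 / α) ^ 2 * (a + (2 : ℝ)⁻¹ * b * a ^ 2) ^ 2 ≤ C)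
    {κ : ℝ} (hκ : kappa₀ (4 * 2 ^ d) (2 * d) ≤ κ / 2) (hκ0 : 0 < κ)
    {L : ℕ} (hL : 0 < L) {j n : ℕ} (hjn : j ≤ n) {β : ℝ} (hβ0 : 0 ≤ β)
    (x : Pt d) (ℰ : LocDom d → (Λ → T → 𝔄) → F)
    (hf : ∀ X, SecondAbove (L ^ (n - j)) x X →
      AnalyticOnNhd ℂ (fun A' : Λ → T → V => ℰ X (fun ν y => exp (ρ (A' ν y)))) (Metric.ball 0 α))
    (hS : ∀ X, SecondAbove (L ^ (n - j)) x X → ∀ A' ∈ Metric.ball (0 : Λ → T → V) α,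
      ‖ℰ X (fun ν y => exp (ρ (A' ν y)))‖ ≤ E₀ * Real.exp (-κ * treeLen X.1))
    (lam : T → V) (c ℓ : Λ → T → V) (hcn : ‖c‖ ≤ a * (L : ℝ) ^ ((j : ℝ) - n))
    (hlam : ‖lam‖ ≤ a * (L : ℝ) ^ ((j : ℝ) - n)) (hℓ : ‖ℓ‖ ≤ a * ((L : ℝ) ^ ((j : ℝ) - n)) ^ 2)
    (m : LocDom d → ℝ)
    (hm : ∀ X, SecondAbove (L ^ (n - j)) x X → |m X| ≤
      ‖(2 : ℝ)⁻¹ • fderiv ℝ (fderiv ℝ (fun A' : Λ → T → V => ℰ X (fun ν y => exp (ρ (A' ν y))))) 0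
        (ℓ + (2 : ℝ)⁻¹ • fun ν y => eV.symm ⁅eV (lam y), eV (c ν y)⁆)
        (ℓ + (2 : ℝ)⁻¹ • fun ν y => eV.symm ⁅eV (lam y), eV (c ν y)⁆)‖) :
    (Summable fun X : LocDom d => if x ∈ X.1 then m X else 0) ∧
    |∑ X ∈ firstFinset (L ^ (n - j)) x, m X - ∑' X : LocDom d, (if x ∈ X.1 then m X else 0)|
      ≤ (C * E₀ * K₀ (4 * 2 ^ d) (2 * d) * (((5 : ℝ) / κ) ^ 5 * Real.exp (-(5 : ℝ))))
        * ((L : ℝ) ^ ((j : ℝ) - n)) ^ ((5 : ℝ) - β) := by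
  have hN : 0 < L ^ (n - j) := pow_pos hL _
  obtain ⟨hs, hR⟩ := extensionDiff_secondAbove_le eV ρ hα hE₀ hb0 hb ha hC hκ hκ0 hL hjn hβ0 x ℰ hf hS lam c ℓ
    hcn hlam hℓ m hm
  exact ⟨summable_above hN x hs, abs_sum_first_sub_tsum_le hN x hs hR⟩

end Chart

/-! ## §5. Torus ↔ `L⁻ʲZ^d`: the first class above `□_z` identified with the first class above `x` -/

/-- **The first-class sum of the torus, rewritten on `L⁻ʲZ^d`**: for a torus cube system `G` (`B12TreeDecay.CubeSystem`,
abstract class predicate `second` above the cube `□_z` as in `…Eq356ExtensionFeed`) and terms `mT`, GIVEN an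
identification `e` of its first-class domains above `□_z` with the first class above `x` on the infinite lattice
carrying the same terms `mZ` ((2.27)(i) «it depends on U_k restricted to X» + the inductive construction; a HYPOTHESIS
here), the torus sum «over all such domains» equals the whole-lattice series over «X containing the point z» minus the
second-class series. [cite: Balaban1988Convergent, p.281, (2.27) p.259] -/
theorem sum_torusFirst_eq_of_equiv {Sy : LocDomainSys} (G : CubeSystem Sy) (cz : G.Cube)
    (second : Sy.Dom → Prop) [DecidablePred second] (mT : Sy.Dom → ℝ) {N : ℕ} (hN : 0 < N) (x : Pt d)
    (mZ : LocDom d → ℝ)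
    (e : {X // X ∈ (G.above cz).filter (fun X => ¬ second X)} ≃ {X : LocDom d // FirstAbove N x X})
    (he : ∀ X, mT X.1 = mZ (e X).1)
    (hs : Summable fun X : LocDom d => if SecondAbove N x X then mZ X else 0) :
    ∑ X ∈ (G.above cz).filter (fun X => ¬ second X), mT X
      = ∑' X : LocDom d, (if x ∈ X.1 then mZ X else 0)
        - ∑' X : LocDom d, (if SecondAbove N x X then mZ X else 0) := by
  classical
  haveI : Fintype {X : LocDom d // FirstAbove N x X} :=
    Fintype.ofFinset (firstFinset N x) fun _ => mem_firstFinset hN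
  have h1 : ∑ X ∈ (G.above cz).filter (fun X => ¬ second X), mT X
      = ∑ X : {X // X ∈ (G.above cz).filter (fun X => ¬ second X)}, mT X.1 :=
    (Finset.sum_coe_sort _ _).symm
  have h2 : ∑ X : {X // X ∈ (G.above cz).filter (fun X => ¬ second X)}, mT X.1
      = ∑ Y : {X : LocDom d // FirstAbove N x X}, mZ Y.1 :=
    Fintype.sum_equiv e (fun X => mT X.1) (fun Y => mZ Y.1) he
  have h3 : ∑ Y : {X : LocDom d // FirstAbove N x X}, mZ Y.1 = ∑ X ∈ firstFinset N x, mZ X :=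
    (Finset.sum_subtype (firstFinset N x) (fun _ => mem_firstFinset hN) mZ).symm
  rw [h1, h2, h3, tsum_above_eq_sum_first_add_tsum_second hN x hs]
  ring

/-- **The passage from the torus's domains to «all domains X ∈ 𝐃_j for the space L⁻ʲZ^d»**, signed form: under the
identification `e` of `sum_torusFirst_eq_of_equiv`, any bound `R` on the second-class series of `L⁻ʲZ^d` above `x` (§2,
or `extensionDiff_secondAbove_le` at chart level) bounds `|Σ_{torus first class above □_z} mT − Σ'_{X ∋ x} mZ|` — «The
difference between the two sums contributes to the irrelevant terms only, by the bounds (3.48)». [cite: Balaban1988Convergent,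
p.281, (3.48) p.280] -/
theorem abs_sum_torusFirst_sub_tsum_le {Sy : LocDomainSys} (G : CubeSystem Sy) (cz : G.Cube)
    (second : Sy.Dom → Prop) [DecidablePred second] (mT : Sy.Dom → ℝ) {N : ℕ} (hN : 0 < N) (x : Pt d)
    (mZ : LocDom d → ℝ)
    (e : {X // X ∈ (G.above cz).filter (fun X => ¬ second X)} ≃ {X : LocDom d // FirstAbove N x X})
    (he : ∀ X, mT X.1 = mZ (e X).1) {R : ℝ}
    (hs : Summable fun X : LocDom d => if SecondAbove N x X then mZ X else 0)
    (hR : |∑' X : LocDom d, (if SecondAbove N x X then mZ X else 0)| ≤ R) :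
    |∑ X ∈ (G.above cz).filter (fun X => ¬ second X), mT X - ∑' X : LocDom d, (if x ∈ X.1 then mZ X else 0)|
      ≤ R := by
  rw [sum_torusFirst_eq_of_equiv G cz second mT hN x mZ e he hs]
  have eq : ∑' X : LocDom d, (if x ∈ X.1 then mZ X else 0)
      - ∑' X : LocDom d, (if SecondAbove N x X then mZ X else 0)
      - ∑' X : LocDom d, (if x ∈ X.1 then mZ X else 0)
      = -∑' X : LocDom d, (if SecondAbove N x X then mZ X else 0) := by ring
  rw [eq, abs_neg]
  exact hR

/-! ## §6. (v1.1) The identification CONSTRUCTED for the window carrier `TreeLengthCubeSystem.cubeSys B` -/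

section Window

open TreeLengthCubeSystem

/-- **The first class above `c` of the window system IS the first class above `c` on `L⁻ʲZ^d`** (same cube sets): for a
window `B ⊇ □^{∼2}(c)` (hypothesis `hWB`), the domains of `cubeSys B` above the cell `c` outside the second class
`…Eq348ClassGeometry.SecondClass B N c` («X ⊂ □^{∼2}») correspond one-to-one to the localization domains `Y ∈ 𝐃_j` of the
infinite lattice with `FirstAbove N c Y`, by `X ↦ X` (a domain of the window is a non-empty face-connected family of cubes
of `B`; a first-class domain of `L⁻ʲZ^d` above `c` lies in `□^{∼2}(c) ⊆ B`).  Stated as the EXISTENCE of an `Equiv`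
preserving the family of cubes (theorem level; no new definition). [cite: Balaban1988Convergent, p.279 (the two cases
(I.3.5)), p.281] -/
theorem exists_firstClassEquiv_window (B : Finset (Pt d)) (N : ℕ) (c : Cell B)
    (hWB : ∀ y, InEnl N 2 c.1 y → y ∈ B) :
    ∃ e : {X // X ∈ ((cubeSys B).above c).filter (fun X => ¬ SecondClass B N c X)}
        ≃ {Y : LocDom d // FirstAbove N c.1 Y}, ∀ X, (e X).1.1 = X.1.1 := by
  classical
  have key : ∀ X : (sys B).Dom,
      X ∈ ((cubeSys B).above c).filter (fun X => ¬ SecondClass B N c X) ↔ c.1 ∈ X.1 ∧ ∀ y ∈ X.1, InEnl N 2 c.1 y := by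
    intro X
    rw [Finset.mem_filter, CubeSystem.mem_above, not_secondClass_iff]
    exact and_congr_left fun _ => mem_cellsOf
  refine ⟨{ toFun := fun X => ⟨⟨X.1.1, X.1.2.2.1, X.1.2.2.2⟩, (key X.1).1 X.2⟩
            invFun := fun Y => ⟨⟨Y.1.1, fun y hy => hWB y (Y.2.2 y hy), Y.1.2.1, Y.1.2.2⟩, (key _).2 Y.2⟩
            left_inv := fun X => Subtype.ext (Subtype.ext rfl)
            right_inv := fun Y => Subtype.ext (Subtype.ext rfl) }, fun X => rfl⟩

/-- **The §5 identity for the window carrier, with NO identification hypothesis**: for `B ⊇ □^{∼2}(c)` and ONE family of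
terms `m` on the localization domains of `L⁻ʲZ^d` (read on a window domain through its family of cubes), the window's
first-class sum above `c` equals the whole-lattice series over «X containing the point z» minus the second-class series —
«we extend the sum on the right-hand side to all domains X ∈ 𝐃_j for the space L⁻ʲZ^d, X containing the point z».
[cite: Balaban1988Convergent, p.281, (3.56)–(3.57) p.281] -/
theorem sum_windowFirst_eq (B : Finset (Pt d)) {N : ℕ} (hN : 0 < N) (c : Cell B)
    (hWB : ∀ y, InEnl N 2 c.1 y → y ∈ B) (m : LocDom d → ℝ)
    (hs : Summable fun Y : LocDom d => if SecondAbove N c.1 Y then m Y else 0) :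
    ∑ X ∈ ((cubeSys B).above c).filter (fun X => ¬ SecondClass B N c X), m ⟨X.1, X.2.2.1, X.2.2.2⟩
      = ∑' Y : LocDom d, (if c.1 ∈ Y.1 then m Y else 0)
        - ∑' Y : LocDom d, (if SecondAbove N c.1 Y then m Y else 0) := by
  classical
  obtain ⟨e, he⟩ := exists_firstClassEquiv_window B N c hWB
  refine sum_torusFirst_eq_of_equiv (cubeSys B) c (SecondClass B N c)
    (fun X : (sys B).Dom => m ⟨X.1, X.2.2.1, X.2.2.2⟩) hN c.1 m e (fun X => ?_) hs
  have hX : (⟨X.1.1, X.1.2.2.1, X.1.2.2.2⟩ : LocDom d) = (e X).1 := Subtype.ext (he X).symm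
  exact congrArg m hX

variable {𝔄 : Type*} [NormedRing 𝔄] [NormedAlgebra ℝ 𝔄] {Λ T : Type*} [Fintype Λ] [Fintype T]
  {V : Type*} [NormedAddCommGroup V] [NormedSpace ℂ V] {F : Type*} [NormedAddCommGroup F]
  [NormedSpace ℂ F] [CompleteSpace F]

open NormedSpace (exp)

-- (the nested operator space over the iterated `Pi` type: one more level of pending instance synthesis)
set_option maxSynthPendingDepth 3 in
/-- **p. 281 for the window carrier, hypothesis-free identification**: under the chart hypotheses of
`extensionDiff_secondAbove_le` on the second class of `L⁻ʲZ^d` above the cell `c` (scale data `L ≥ 1`, `j ≤ n`,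
`N = Lⁿ⁻ʲ`; window `B ⊇ □^{∼2}(c)`), for ONE family of real main terms `m` on `LocDom d`: the first-class sum of the
window system `cubeSys B` above `c` (the sum «over all such domains» on the cell's concrete carrier of (3.48), whose
second class `…Eq348ClassGeometry.SecondClass` has `hclass` PROVED there) differs from the whole-lattice series
`Σ'_{Y ∋ c} m(Y)` by at most `(C·E₀·K₀(4·2^d, 2d)·(5/κ)⁵e⁻⁵)·(L^{j−n})^{5−β}` — «The difference between the two sums
contributes to the irrelevant terms only, by the bounds (3.48)». [cite: Balaban1988Convergent, (3.56)–(3.57) p.281,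
(3.48) p.280, (2.27) p.259; Balaban1987RG1, (1.18) p.263, (4.16)–(4.17) p.285; Balaban1988RG2Cluster, (1.26) p.8] -/
theorem extension357_window_of_charts (B : Finset (Pt d))
    {𝔤 : Type*} [LieRing 𝔤] [LieAlgebra ℝ 𝔤] (eV : V ≃ₗ[ℝ] 𝔤) (ρ : V →L[ℝ] 𝔄) {α : ℝ} (hα : 0 < α) {E₀ : ℝ}
    (hE₀ : 0 ≤ E₀) {b : ℝ} (hb0 : 0 ≤ b) (hb : ∀ x y : V, ‖eV.symm ⁅eV x, eV y⁆‖ ≤ b * ‖x‖ * ‖y‖)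
    {a : ℝ} (ha : 0 ≤ a) {C : ℝ} (hC : (2 : ℝ)⁻¹ * (4 / α) ^ 2 * (a + (2 : ℝ)⁻¹ * b * a ^ 2) ^ 2 ≤ C)
    {κ : ℝ} (hκ : kappa₀ (4 * 2 ^ d) (2 * d) ≤ κ / 2) (hκ0 : 0 < κ)
    {L : ℕ} (hL : 0 < L) {j n : ℕ} (hjn : j ≤ n) {β : ℝ} (hβ0 : 0 ≤ β)
    (c : Cell B) (hWB : ∀ y, InEnl (L ^ (n - j)) 2 c.1 y → y ∈ B) (ℰ : LocDom d → (Λ → T → 𝔄) → F)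
    (hf : ∀ X, SecondAbove (L ^ (n - j)) c.1 X →
      AnalyticOnNhd ℂ (fun A' : Λ → T → V => ℰ X (fun ν y => exp (ρ (A' ν y)))) (Metric.ball 0 α))
    (hS : ∀ X, SecondAbove (L ^ (n - j)) c.1 X → ∀ A' ∈ Metric.ball (0 : Λ → T → V) α,
      ‖ℰ X (fun ν y => exp (ρ (A' ν y)))‖ ≤ E₀ * Real.exp (-κ * treeLen X.1))
    (lam : T → V) (cc ℓ : Λ → T → V) (hcn : ‖cc‖ ≤ a * (L : ℝ) ^ ((j : ℝ) - n))
    (hlam : ‖lam‖ ≤ a * (L : ℝ) ^ ((j : ℝ) - n)) (hℓ : ‖ℓ‖ ≤ a * ((L : ℝ) ^ ((j : ℝ) - n)) ^ 2)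
    (m : LocDom d → ℝ)
    (hm : ∀ X, SecondAbove (L ^ (n - j)) c.1 X → |m X| ≤
      ‖(2 : ℝ)⁻¹ • fderiv ℝ (fderiv ℝ (fun A' : Λ → T → V => ℰ X (fun ν y => exp (ρ (A' ν y))))) 0
        (ℓ + (2 : ℝ)⁻¹ • fun ν y => eV.symm ⁅eV (lam y), eV (cc ν y)⁆)
        (ℓ + (2 : ℝ)⁻¹ • fun ν y => eV.symm ⁅eV (lam y), eV (cc ν y)⁆)‖) :
    |∑ X ∈ ((cubeSys B).above c).filter (fun X => ¬ SecondClass B (L ^ (n - j)) c X), m ⟨X.1, X.2.2.1, X.2.2.2⟩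
        - ∑' Y : LocDom d, (if c.1 ∈ Y.1 then m Y else 0)|
      ≤ (C * E₀ * K₀ (4 * 2 ^ d) (2 * d) * (((5 : ℝ) / κ) ^ 5 * Real.exp (-(5 : ℝ))))
        * ((L : ℝ) ^ ((j : ℝ) - n)) ^ ((5 : ℝ) - β) := by
  classical
  have hN : 0 < L ^ (n - j) := pow_pos hL _
  obtain ⟨hs, hR⟩ := extensionDiff_secondAbove_le eV ρ hα hE₀ hb0 hb ha hC hκ hκ0 hL hjn hβ0 c.1 ℰ hf hS lam cc ℓ
    hcn hlam hℓ m hm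
  obtain ⟨e, he⟩ := exists_firstClassEquiv_window B (L ^ (n - j)) c hWB
  refine abs_sum_torusFirst_sub_tsum_le (cubeSys B) c (SecondClass B (L ^ (n - j)) c)
    (fun X : (sys B).Dom => m ⟨X.1, X.2.2.1, X.2.2.2⟩) hN c.1 m e (fun X => ?_) hs hR
  have hX : (⟨X.1.1, X.1.2.2.1, X.1.2.2.2⟩ : LocDom d) = (e X).1 := Subtype.ext (he X).symm
  exact congrArg m hX

end Window

end

end Literature.MathematicalPhysics.QuantumFieldTheory.Balaban1983to89.B14.Eq357ExtensionZd
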